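import Literature.Computability.MetaComplexity.OrderParityExtension
import Literature.Computability.MetaComplexity.OrderingPrinciple
import Literature.Computability.MetaComplexity.ResLinTreeLikeCompleteness
import HarnessLib

/-!
# The ordering principle in tree-like Res(⊕): size `≥ 2^{n-1}` and clause space `≥ n - 1` (GOR 2024, Thm 4)

* **Lemma 3** (`isExtensible_orderingCNF`) [Gryaznov–Ovcharov–Riazanov 2024, Lemma 3; Gryaznov
  2019, Lemma 3.4]: `Ordering_n` is `(n-1)`-extensible w.r.t. `ORDER_n` (`ResLinExtensible.lean`):
  every linear system over `𝔽₂` with fewer than `n - 1` equations that has an `ORDER_n`-proper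
  solution has, for every non-minimality clause `NM_i`, a proper solution satisfying `NM_i`. Proof:
  a proper solution is the assignment of its ranking (`OrderingPrinciple.lean`); an equation
  restricted to the variables `x_{kl}` is a set of ordered pairs whose parity under a ranking is
  `OrderParity.pairParity` (`sum_rankAssign`, junk variables kept at their values); now
  `OrderParity.exists_ranking_lt` (`OrderParityExtension.lean`, the printed induction).
* **Theorem 4** (`two_pow_le_length_orderingCNF_treeLike`, `le_resLinClauseSpace_orderingCNF`):
  every TREE-LIKE Res(⊕) refutation (semantic weakening) of `Ordering_n` has `≥ 2^{n-1}` lines and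
  every configuration-style Res(⊕) refutation keeps `≥ n - 1` linear clauses in memory at some
  moment; `ℕ∞` form; non-vacuity (`exists_treeLike_isResLinRefutation_orderingCNF`: `Ordering_n` is
  unsatisfiable for `n ≥ 1` and has a tree-like refutation with `3·2^{n²} - 1` lines).
* **Tightness of the method** (`not_isExtensible_orderingCNF`): `Ordering_n` is NOT `n`-extensible
  w.r.t. `ORDER_n` (the `n - 1` equations `x_{0j} = 1` force the minimum), so `2^{n-1}` / `n - 1` is
  exactly what extensibility w.r.t. `ORDER_n` yields.

Constants vs print: GOR state "`(n-2)`-extensible", `2^{n-2}` and `n - 2` (Gryaznov 2019 Thm 3.5: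
`2^{n-2}`); the printed proofs treat systems "with at most `n - 2` equations" (Gryaznov 2019,
Lemma 3.4 verbatim; GOR's proof: "`A'y = b` is at most `n - 2`", "`B'x' = c` has at most `n - 3`
equations"), i.e. give `(n-1)`-extensibility in GOR's own convention ("fewer than `m` equations"),
whence `2^{n-1}` and `n - 1` here — one better than the printed statements, exactly what the printed
proof gives (as for `PHPᵐₙ`, `PigeonholeResLinTreeLike.lean`). In print `Ordering_n` has
polynomial-size resolution (hence dag-like Res(⊕)) refutations (Stålmarck 1996), so it separates
resolution from tree-like Res(⊕) [GOR 2024, §1]; that upper bound is not reproduced here.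

## References

* S. Gryaznov, S. Ovcharov, A. Riazanov, ACM Trans. Comput. Theory 16(3) (2024) = arXiv:2404.08370,
  §3.1.2, Lemma 3, Theorem 4 [GryaznovOvcharovRiazanov2024].
* S. Gryaznov, CSR 2019, LNCS 11532, Lemma 3.4, Theorem 3.5 [Gryaznov2019].
-/

namespace Literature.Computability.MetaComplexity

open _root_.Computability Complexity Finset OrderParity

/-! ### Equations as sets of ordered pairs -/

/-- The ordered pairs `(k, l)`, `k ≠ l < n`, whose variable `x_{kl}` occurs in the linear form `f`.
[Gryaznov–Ovcharov–Riazanov 2024, Lemma 3 (proof: "`x_{ij}` appears in some equation in `Ax = b`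
with a non-zero coefficient")] [cite: GryaznovOvcharovRiazanov2024, Lemma 3] -/
def litPairs (n : ℕ) (f : Finset ℕ) : Finset (ℕ × ℕ) :=
  (Finset.range n).offDiag.filter fun p => ordVar n p.1 p.2 ∈ f

/-- Pairs of a form are off-diagonal pairs of `[n]`. [folklore] -/
theorem mem_litPairs {n : ℕ} {f : Finset ℕ} {p : ℕ × ℕ} :
    p ∈ litPairs n f ↔ (p.1 < n ∧ p.2 < n ∧ p.1 ≠ p.2) ∧ ordVar n p.1 p.2 ∈ f := by
  unfold litPairs
  rw [Finset.mem_filter, Finset.mem_offDiag, Finset.mem_range, Finset.mem_range]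

/-- The variables of `Ordering_n` occurring in `f` are the indices of its pairs. [folklore] -/
theorem filter_isOrdVar_eq_image {n : ℕ} (f : Finset ℕ) :
    f.filter (fun v => v < n * n ∧ v / n ≠ v % n) =
      (litPairs n f).image fun p => ordVar n p.1 p.2 := by
  ext v
  rw [Finset.mem_filter, Finset.mem_image]
  constructor
  · rintro ⟨hv, hlt, hne⟩
    have hn : 0 < n := Nat.pos_of_ne_zero fun h0 => by rw [h0] at hlt; simp at hlt
    have hk : v / n < n := Nat.div_lt_of_lt_mul hlt
    have hl : v % n < n := Nat.mod_lt v hn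
    have hv' : ordVar n (v / n) (v % n) = v := Nat.div_add_mod' v n
    exact ⟨(v / n, v % n), mem_litPairs.2 ⟨⟨hk, hl, hne⟩, by rw [hv']; exact hv⟩, hv'⟩
  · rintro ⟨p, hp, rfl⟩
    obtain ⟨⟨hk, hl, hne⟩, hmem⟩ := mem_litPairs.1 hp
    refine ⟨hmem, ordVar_lt hk hl, ?_⟩
    rw [ordVar_div hl, ordVar_mod hl]; exact hne

/-- **Parity of a form under the assignment of a ranking** = the pair parity of its pairs plus the
(ranking-independent) contribution of the junk variables. [Gryaznov–Ovcharov–Riazanov 2024, Lemma 3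
(proof: the system evaluated on encodings of orders)] [cite: GryaznovOvcharovRiazanov2024, Lemma 3] -/
theorem sum_rankAssign (n : ℕ) (ρ : ℕ → ℕ) (σ : ℕ → Bool) (f : Finset ℕ) :
    ∑ v ∈ f, (if rankAssign n ρ σ v = true then (1 : ZMod 2) else 0) =
      pairParity ρ (litPairs n f) +
        ∑ v ∈ f with ¬ (v < n * n ∧ v / n ≠ v % n), (if σ v = true then (1 : ZMod 2) else 0) := by
  rw [← Finset.sum_filter_add_sum_filter_not f (fun v => v < n * n ∧ v / n ≠ v % n)]
  congr 1
  · rw [filter_isOrdVar_eq_image, pairParity]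
    have hinj : Set.InjOn (fun p : ℕ × ℕ => ordVar n p.1 p.2) (litPairs n f : Finset (ℕ × ℕ)) := by
      intro p hp q hq h
      obtain ⟨⟨_, hpl, _⟩, -⟩ := mem_litPairs.1 hp
      obtain ⟨⟨_, hql, _⟩, -⟩ := mem_litPairs.1 hq
      have h1 := congrArg (· / n) h
      have h2 := congrArg (· % n) h
      simp only [ordVar_div hpl, ordVar_div hql, ordVar_mod hpl, ordVar_mod hql] at h1 h2
      exact Prod.ext h1 h2
    rw [Finset.sum_image hinj]
    refine Finset.sum_congr rfl fun p hp => ?_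
    obtain ⟨⟨hk, hl, hne⟩, -⟩ := mem_litPairs.1 hp
    rw [rankAssign_ordVar ρ σ hk hl hne, cmpBit]
    by_cases h : ρ p.1 < ρ p.2 <;> simp [h]
  · refine Finset.sum_congr rfl fun v hv => ?_
    obtain ⟨-, hv⟩ := Finset.mem_filter.1 hv
    unfold rankAssign
    rw [if_neg hv]

/-- Two assignments of rankings with the same pair parities on the pairs of `f` give the equation
`(f = b)` the same value. [Gryaznov–Ovcharov–Riazanov 2024, Lemma 3 (proof)]
[cite: GryaznovOvcharovRiazanov2024, Lemma 3] -/
theorem linLit_eval_rankAssign_eq {n : ℕ} {ρ ρ' : ℕ → ℕ} (σ : ℕ → Bool) {f : Finset ℕ} (b : Bool)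
    (h : pairParity ρ' (litPairs n f) = pairParity ρ (litPairs n f)) :
    LinLit.eval (rankAssign n ρ' σ) (f, b) = LinLit.eval (rankAssign n ρ σ) (f, b) := by
  apply Bool.eq_iff_iff.2
  rw [linLit_eval_eq_true_iff_sum, linLit_eval_eq_true_iff_sum, sum_rankAssign, sum_rankAssign, h]

/-! ### Lemma 3: `Ordering_n` is `(n-1)`-extensible w.r.t. `ORDER_n` -/

/-- **Lemma 3** [Gryaznov–Ovcharov–Riazanov 2024, Lemma 3 ("`Ordering_n` is `(n-2)`-extensible
w.r.t. `ORDER_n`" — the proof gives `n - 1` in their convention); Gryaznov 2019, Lemma 3.4]: every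
linear system with fewer than `n - 1` equations that has an `ORDER_n`-proper solution has, for every
non-minimality clause, a proper solution satisfying it. [cite: GryaznovOvcharovRiazanov2024, Lemma 3] -/
theorem isExtensible_orderingCNF (n : ℕ) :
    IsExtensible (orderingCNF n) (linOrderClauses n) (n - 1) := by
  classical
  intro Φ hlen hsol c hc hcF
  obtain ⟨σ, hσF, hσΦ⟩ := hsol
  -- `c` is the non-minimality clause of some `i < n`
  obtain ⟨i, hi, rfl⟩ : ∃ i < n, c = nonMinClause n i := by
    rcases mem_orderingCNF_iff.1 hc with h | h
    · exact absurd h hcF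
    · exact h
  -- the ranking of `σ` and the pair sets of the equations
  have hσeq : rankAssign n (rankOf n σ) σ = σ := rankAssign_rankOf hσF
  have hr₀ := injOn_rankOf hσF
  set Ψ : List (Finset (ℕ × ℕ)) := Φ.map fun e => litPairs n e.1 with hΨ
  have hΨlen : Ψ.length + 2 ≤ (Finset.range n).card := by
    rw [hΨ, List.length_map, Finset.card_range]; omega
  have hΨpairs : ∀ T ∈ Ψ, ∀ p ∈ T, p.1 ∈ Finset.range n ∧ p.2 ∈ Finset.range n ∧ p.1 ≠ p.2 := by
    intro T hT p hp
    rw [hΨ, List.mem_map] at hT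
    obtain ⟨e, -, rfl⟩ := hT
    obtain ⟨⟨hk, hl, hne⟩, -⟩ := mem_litPairs.1 hp
    exact ⟨Finset.mem_range.2 hk, Finset.mem_range.2 hl, hne⟩
  -- a ranking with the same parities in which `i` is not the minimum
  obtain ⟨r', hr', hpar, x, hx, hxi⟩ :=
    exists_ranking_lt hr₀ (Finset.mem_range.2 hi) hΨlen hΨpairs
  rw [Finset.mem_range] at hx
  have hxne : x ≠ i := fun h => by rw [h] at hxi; exact lt_irrefl _ hxi
  refine ⟨rankAssign n r' σ, isFProper_rankAssign hr' σ, ?_, ?_⟩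
  · -- the equations keep their values
    rintro ⟨f, b⟩ he
    have hT : litPairs n f ∈ Ψ := by rw [hΨ, List.mem_map]; exact ⟨(f, b), he, rfl⟩
    rw [linLit_eval_rankAssign_eq σ b (hpar _ hT), hσeq]
    exact hσΦ _ he
  · -- `NM_i` holds: `x ≺ i`
    rw [eval_nonMinClause_iff]
    refine ⟨x, hx, hxne, ?_⟩
    rw [rankAssign_ordVar r' σ hx hi hxne, decide_eq_true_eq]
    exact hxi

/-! ### Theorem 4: tree-like size and clause space of `Ordering_n` -/

/-- **Theorem 4, tree-like size** [Gryaznov–Ovcharov–Riazanov 2024, Thm 4 (`2^{n-2}` in print);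
Gryaznov 2019, Thm 3.5]: every TREE-LIKE Res(⊕) refutation (resolution rule + semantic weakening;
every line used as a premise at most once) of `Ordering_n` has at least `2^{n-1}` lines.
[cite: GryaznovOvcharovRiazanov2024, Theorem 4] -/
theorem two_pow_le_length_orderingCNF_treeLike {n : ℕ} {π : List ResLinLine}
    (hπ : IsResLinRefutation (orderingCNF n) π)
    (htree : ∀ i : ℕ, (π.map fun l => l.premises.count i).sum ≤ 1) : 2 ^ (n - 1) ≤ π.length :=
  two_pow_le_length_of_isExtensible (isExtensible_orderingCNF n)
    (exists_isFProper_linOrderClauses n) hπ htree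

/-- **Theorem 4, clause space** [Gryaznov–Ovcharov–Riazanov 2024, Thm 4 (`n - 2` in print)]: every
configuration-style Res(⊕) refutation of `Ordering_n` keeps at least `n - 1` linear clauses in
memory at some moment. [cite: GryaznovOvcharovRiazanov2024, Theorem 4] -/
theorem le_resLinClauseSpace_orderingCNF {n : ℕ} {π : List (Finset LinClause)}
    (hπ : IsResLinSpaceRefutation (orderingCNF n) π) : n - 1 ≤ resLinClauseSpace π :=
  le_resLinClauseSpace_of_isExtensible (isExtensible_orderingCNF n)
    (exists_isFProper_linOrderClauses n) hπ

/-- Theorem 4, clause space, `ℕ∞` form: the Res(⊕) clause space of `Ordering_n` is at least `n - 1`.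
[Gryaznov–Ovcharov–Riazanov 2024, Thm 4] [cite: GryaznovOvcharovRiazanov2024, Theorem 4] -/
theorem le_minResLinClauseSpace_orderingCNF (n : ℕ) :
    ((n - 1 : ℕ) : ℕ∞) ≤ minResLinClauseSpace (orderingCNF n) :=
  le_minResLinClauseSpace_of_isExtensible (isExtensible_orderingCNF n)
    (exists_isFProper_linOrderClauses n)

/-! ### Non-vacuity: tree-like refutations of `Ordering_n` exist -/

/-- **Theorem 4 is not vacuous**: for `n ≥ 1` the CNF `Ordering_n` HAS tree-like Res(⊕) refutations
— the decision tree on the `n²` variable indices below `n²` (`ResLinTreeLikeCompleteness.lean`),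
with exactly `3·2^{n²} - 1` lines; so the minimum tree-like size lies between `2^{n-1}` and `3·2^{n²}`.
[Itsykson–Sokolov 2020, §2 (completeness); Gryaznov–Ovcharov–Riazanov 2024, §3.1.2]
[cite: ItsyksonSokolov2020, §2] -/
theorem exists_treeLike_isResLinRefutation_orderingCNF {n : ℕ} (hn : 1 ≤ n) :
    ∃ π : List ResLinLine, IsResLinRefutation (orderingCNF n) π ∧
      (∀ i : ℕ, (π.map fun l => l.premises.count i).sum ≤ 1) ∧ π.length + 1 = 3 * 2 ^ (n * n) := by
  have hvars : ∀ c ∈ orderingCNF n, ∀ l ∈ c, l.1 ∈ List.range (n * n) :=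
    fun c hc l hl => List.mem_range.2 (fst_lt_of_mem_orderingCNF hc hl)
  obtain ⟨π, hπ, htree, hlen⟩ := exists_treeLike_isResLinRefutation
    (orderingCNF_not_satisfiable hn) List.nodup_range hvars
  exact ⟨π, hπ, htree, by simpa using hlen⟩

/-- The two bounds side by side: for `n ≥ 1` there is a tree-like Res(⊕) refutation of
`Ordering_n`, and every one has at least `2^{n-1}` lines. [Gryaznov–Ovcharov–Riazanov 2024, Thm 4;
folklore upper bound] [cite: GryaznovOvcharovRiazanov2024, Theorem 4] -/
theorem treeLike_orderingCNF_bounds {n : ℕ} (hn : 1 ≤ n) :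
    (∃ π : List ResLinLine, IsResLinRefutation (orderingCNF n) π ∧
      (∀ i : ℕ, (π.map fun l => l.premises.count i).sum ≤ 1) ∧ π.length < 3 * 2 ^ (n * n)) ∧
    (∀ π : List ResLinLine, IsResLinRefutation (orderingCNF n) π →
      (∀ i : ℕ, (π.map fun l => l.premises.count i).sum ≤ 1) → 2 ^ (n - 1) ≤ π.length) := by
  obtain ⟨π, hπ, htree, hlen⟩ := exists_treeLike_isResLinRefutation_orderingCNF hn
  exact ⟨⟨π, hπ, htree, by omega⟩,
    fun π hπ htree => two_pow_le_length_orderingCNF_treeLike hπ htree⟩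

/-! ### Tightness: `Ordering_n` is not `n`-extensible w.r.t. `ORDER_n` -/

/-- **The extensibility parameter is exact**: `Ordering_n` is NOT `n`-extensible w.r.t. `ORDER_n`
(`n ≥ 1`) — the `n - 1` equations `x_{0j} = 1` (`0 < j < n`) have the natural order as a proper
solution, and every proper solution of them makes `0` the minimum, falsifying `NM_0`. So `2^{n-1}`
and `n - 1` are the best bounds Theorems 1–2 of GOR can give for `Ordering_n` w.r.t. `ORDER_n`.
[Gryaznov–Ovcharov–Riazanov 2024, §3.1.2; folklore] [folklore] -/
theorem not_isExtensible_orderingCNF {n : ℕ} (hn : 1 ≤ n) :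
    ¬ IsExtensible (orderingCNF n) (linOrderClauses n) n := by
  classical
  intro hext
  -- the system `x_{0j} = 1`, `0 < j < n`
  set Φ : List LinLit := ((List.range n).filter fun j => j ≠ 0).map
    fun j => (({ordVar n 0 j} : Finset ℕ), true) with hΦ
  have hlen : Φ.length < n := by
    rw [hΦ, List.length_map]
    have h1 := List.length_filter_le (fun j => decide (j ≠ 0)) (List.range n)
    have h2 : ((List.range n).filter fun j => j ≠ 0).length ≠ (List.range n).length := fun h => by
      have := List.length_filter_eq_length_iff.1 h 0 (List.mem_range.2 (by omega))
      simp at this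
    rw [List.length_range] at h1 h2
    omega
  have hmemΦ : ∀ e, e ∈ Φ ↔ ∃ j, j < n ∧ j ≠ 0 ∧ e = (({ordVar n 0 j} : Finset ℕ), true) := by
    intro e
    simp only [hΦ, List.mem_map, List.mem_filter, List.mem_range, decide_eq_true_eq]
    constructor
    · rintro ⟨j, ⟨hj, hj0⟩, rfl⟩; exact ⟨j, hj, hj0, rfl⟩
    · rintro ⟨j, hj, hj0, rfl⟩; exact ⟨j, ⟨hj, hj0⟩, rfl⟩
  have hsingle : ∀ (τ : ℕ → Bool) (v : ℕ), LinLit.eval τ (({v} : Finset ℕ), true) = τ v := by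
    intro τ v
    have := eval_toLinLit (v, true) τ
    simpa [Literal.toLinLit, Literal.eval] using this
  -- the natural order is a proper solution
  set σ₀ : ℕ → Bool := rankAssign n id fun _ => false with hσ₀
  have hσ₀F : IsFProper (linOrderClauses n) σ₀ := isFProper_rankAssign (fun _ _ _ _ h => h) _
  have hσ₀Φ : ∀ e ∈ Φ, LinLit.eval σ₀ e = true := by
    intro e he
    obtain ⟨j, hj, hj0, rfl⟩ := (hmemΦ e).1 he
    rw [hsingle, hσ₀, rankAssign_ordVar id _ (by omega) hj (Ne.symm hj0)]
    simp only [id, decide_eq_true_eq]; omega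
  -- `NM_0` is a clause of `Ordering_n` outside `ORDER_n` (it is false under the proper `σ₀`)
  have hc : nonMinClause n 0 ∈ orderingCNF n := nonMinClause_mem_orderingCNF (by omega)
  have hcF : nonMinClause n 0 ∉ linOrderClauses n := by
    intro h
    obtain ⟨j, hj, hj0, hσj⟩ := eval_nonMinClause_iff.1 (hσ₀F _ h)
    rw [hσ₀, rankAssign_ordVar id _ hj (by omega) hj0] at hσj
    simp at hσj
  -- extensibility would give a proper solution with `0` not minimal: contradiction
  obtain ⟨τ, hτF, hτΦ, hτc⟩ := hext Φ hlen ⟨σ₀, hσ₀F, hσ₀Φ⟩ _ hc hcF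
  obtain ⟨j, hj, hj0, hτj⟩ := eval_nonMinClause_iff.1 hτc
  have h0j : τ (ordVar n 0 j) = true := by
    have := hτΦ _ ((hmemΦ _).2 ⟨j, hj, hj0, rfl⟩); rwa [hsingle] at this
  obtain ⟨hanti, -, -⟩ := isFProper_linOrderClauses_iff.1 hτF
  exact hanti 0 j (by omega) hj (Ne.symm hj0) ⟨h0j, hτj⟩

end Literature.Computability.MetaComplexity
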